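import Mathlib
import Summits.ResolutionOfSingularities.ResolutionOfSingularities.Theorems.RadicialJungCleanModelsCleanProp44NearLineLocal
import HarnessLib

/-!
# Route `RadicialJung`, crux `CleanModels` (stmt-ResolutionOfSingularities-15917), line `Sketch` rev 35, stub 6 `stub_cleanProp44` (X44c):
# THE BIRTH ORDER IS READ ON THE CURVE — `U − c^p ∈ N + 𝔪^k` iff `Ū − c̄^p ∈ 𝔪̄^k` in `𝒪/N`, and the non-birth test on the curve

Seat decomp-res-hand-2 g20 (structural hand); companion of ✓ `…CleanProp44BirthOrder.lean` / ✓ `…CleanProp44BirthCount.lean` (memo 4e §2.6 (b):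
«the honest birth criterion is germ-theoretic: `ν(c') := sup_G ord_{c'}(F − G^p)` on the curve»).  The birth alternative of hand-2 g18's
✓ `cleanPermissibleAt_of_unit_rep` quantifies `c'` over the local ring `𝒪_{X',x'}` of the THREEFOLD and tests `U − c'^p` against `N + 𝔪²`; the counting
engine lives on the CURVE `𝒪_{X',x'}/N` (a discrete valuation ring; for a near line, a local ring of `ℙ¹_{κ(x)}`).  This file is the dictionary
(pure algebra, def-free; `R` any commutative ring, `N, I` ideals, `mk : R → R/N`):

* `sub_pow_mem_sup_pow_iff_mk` — `v − c^p ∈ N + I^k` iff `mk v − (mk c)^p ∈ (I R/N)^k`; `exists_sub_pow_mem_sup_pow_iff` /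
  `forall_sub_pow_not_mem_sup_pow_iff` — «`ν ≥ k`» / «`ν < k`» for `U` relative to `N` at `I` is the same statement for `Ū` in `R/N` (every `c̄`
  lifts).  So the birth order of g18/g19's stalk statements IS the `ν` of memo §2.6 (b) on the curve, where ✓ `sub_pow_not_mem_map_sup_pow_succ_of_derivation_curve`
  bounds it and ✓ `sum_mul_natDegree_le_of_add_pow_mem` counts it.
* `cleanPermissibleAt_of_unit_rep_of_quotient` — the NON-BIRTH TEST READ ON THE CURVE: in the setting of ✓ `cleanPermissibleAt_of_unit_rep` (`R`
  regular local of dimension `3`, `(c₁, c₂, t)` a regular system, `N = (c₁, c₂)`, unit representative `f v · d^p`), if on the curve `R/N` either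
  `v̄ − c̄^p ∉ 𝔪̄` for every `c̄` («`ν = 0`») or some `v̄ − c̄^p ∈ 𝔪̄ ∖ 𝔪̄²` («`ν = 1`»), then the line is clean-permissible for `N`.  Contrapositive
  (`two_le_birthOrder_of_not_cleanPermissibleAt`, stated without `ν`): at an obstruction point with a unit representative, `v̄ ∈ κ^p` up to `𝔪̄` and NO
  `v̄ − c̄^p` is a uniformizer of the curve — i.e. `2 ≤ ν`, the points which ✓ `card_mul_le_of_add_pow_mem_sq` counts.

Honest framing: OURS, elementary bookkeeping; nothing here proves X44c, any case of `CleanModels`, or resolution of singularities in characteristic `p`.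
Setting only: [cite: CossartPiltant2008, Prop. 4.4 (proof, p. 11)] [cite: Piltant2013, §2 Axiom 4].
-/

noncomputable section

set_option linter.dupNamespace false -- mandated namespace of this single-conjunct summit

open IsLocalRing
open Literature.AlgebraicGeometry.Resolution

namespace Summit.ResolutionOfSingularities.ResolutionOfSingularities.Theorems.RadicialJung.CleanModels

universe u

/-! ## §1 The dictionary `R ↔ R/N` for `v − c^p ∈ N + I^k` -/

section Dictionary

variable {R : Type*} [CommRing R] (N I : Ideal R) (p k : ℕ)

/-- **`v − c^p ∈ N + I^k` iff `v̄ − c̄^p ∈ Ī^k` in `R/N`** (`Ī = I·R/N`). [folklore] -/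
theorem sub_pow_mem_sup_pow_iff_mk (v c : R) :
    v - c ^ p ∈ N ⊔ I ^ k ↔ Ideal.Quotient.mk N v - Ideal.Quotient.mk N c ^ p ∈ (I.map (Ideal.Quotient.mk N)) ^ k := by
  rw [← Ideal.map_pow, ← map_pow, ← map_sub, Ideal.mem_quotient_iff_mem_sup, sup_comm]

/-- **«`ν ≥ k`» is read on the curve**: some `v − c^p ∈ N + I^k` (`c ∈ R`) iff some `v̄ − c̄^p ∈ Ī^k` (`c̄ ∈ R/N`). [folklore] -/
theorem exists_sub_pow_mem_sup_pow_iff (v : R) :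
    (∃ c : R, v - c ^ p ∈ N ⊔ I ^ k) ↔ ∃ c' : R ⧸ N, Ideal.Quotient.mk N v - c' ^ p ∈ (I.map (Ideal.Quotient.mk N)) ^ k := by
  constructor
  · rintro ⟨c, hc⟩
    exact ⟨Ideal.Quotient.mk N c, (sub_pow_mem_sup_pow_iff_mk N I p k v c).mp hc⟩
  · rintro ⟨c', hc'⟩
    obtain ⟨c, rfl⟩ := Ideal.Quotient.mk_surjective c'
    exact ⟨c, (sub_pow_mem_sup_pow_iff_mk N I p k v c).mpr hc'⟩

/-- **«`ν < k`» is read on the curve**: `v − c^p ∉ N + I^k` for every `c ∈ R` iff `v̄ − c̄^p ∉ Ī^k` for every `c̄ ∈ R/N`. [folklore] -/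
theorem forall_sub_pow_not_mem_sup_pow_iff (v : R) :
    (∀ c : R, v - c ^ p ∉ N ⊔ I ^ k) ↔ ∀ c' : R ⧸ N, Ideal.Quotient.mk N v - c' ^ p ∉ (I.map (Ideal.Quotient.mk N)) ^ k := by
  have h := not_congr (exists_sub_pow_mem_sup_pow_iff N I p k v)
  simp only [not_exists] at h
  exact h

/-- The case `k = 1`, `N ≤ I`: `v − c^p ∈ I` iff `v̄ − c̄^p ∈ Ī`. [folklore] -/
theorem sub_pow_mem_iff_mk (hNI : N ≤ I) (v c : R) :
    v - c ^ p ∈ I ↔ Ideal.Quotient.mk N v - Ideal.Quotient.mk N c ^ p ∈ I.map (Ideal.Quotient.mk N) := by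
  have h := sub_pow_mem_sup_pow_iff_mk N I p 1 v c
  rwa [pow_one, pow_one, sup_eq_right.mpr hNI] at h

end Dictionary

/-! ## §2 The non-birth test read on the curve -/

section Curve

variable {R : Type u} {F : Type u} [CommRing R] [IsLocalRing R] [Field F] {p : ℕ} [hp : Fact p.Prime] [CharP F p]
  (f : R →+* F) (hR : IsRegularLocalRing R) (hdim : ringKrullDim R = 3) {c₁ c₂ t : R}
  (h : Ideal.span ({c₁, c₂, t} : Set R) = maximalIdeal R) {G : F} (cc : Fin p → F) (hcc : ∃ j : Fin p, (j : ℕ) ≠ 0 ∧ cc j ≠ 0)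
  {v : R} (hv : IsUnit v) {d : F} (hd : d ≠ 0) (hrep : (∑ j : Fin p, cc j ^ p * G ^ (j : ℕ)) = f v * d ^ p)

/-- The curve ideal `N = (c₁, c₂)` lies in `𝔪`. [folklore] -/
theorem span_pair_le_maximalIdeal_of_span_triple (h : Ideal.span ({c₁, c₂, t} : Set R) = maximalIdeal R) :
    Ideal.span ({c₁, c₂} : Set R) ≤ maximalIdeal R := by
  rw [← h]
  refine Ideal.span_mono fun x hx => ?_
  simp only [Set.mem_insert_iff, Set.mem_singleton_iff] at hx ⊢
  tauto

include hR hdim h hcc hv hd hrep in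
/-- **THE NON-BIRTH TEST READ ON THE CURVE.**  `R` regular local of dimension `3` read in `F` (characteristic `p`) by `f`, `(c₁, c₂, t)` a regular system of
parameters, `N = (c₁, c₂)` the curve, unit representative `f v · d^p` of the line of `G`; write `v̄, 𝔪̄` for the images in the discrete valuation ring `R/N`.
If `v̄ − c̄^p ∉ 𝔪̄` for every `c̄ ∈ R/N` («`ν = 0`: the residue of `v` is not a `p`-th power») or `v̄ − c̄^p ∈ 𝔪̄ ∖ 𝔪̄²` for some `c̄` («`ν = 1`: transversal»),
then the line is clean-permissible at `R` for `N` (lift `c̄`, ✓ `cleanPermissibleAt_of_unit_rep_of_forall/_of_transversal`). [cite: Piltant2013, §2 Axiom 4]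
[cite: CossartPiltant2008, Prop. 4.4 (proof, p. 11)] -/
theorem cleanPermissibleAt_of_unit_rep_of_quotient
    (hcurve : (∀ c' : R ⧸ Ideal.span ({c₁, c₂} : Set R),
        Ideal.Quotient.mk _ v - c' ^ p ∉ (maximalIdeal R).map (Ideal.Quotient.mk (Ideal.span ({c₁, c₂} : Set R)))) ∨
      ∃ c' : R ⧸ Ideal.span ({c₁, c₂} : Set R),
        Ideal.Quotient.mk _ v - c' ^ p ∈ (maximalIdeal R).map (Ideal.Quotient.mk (Ideal.span ({c₁, c₂} : Set R))) ∧
        Ideal.Quotient.mk _ v - c' ^ p ∉ (maximalIdeal R).map (Ideal.Quotient.mk (Ideal.span ({c₁, c₂} : Set R))) ^ 2) :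
    CleanPermissibleAt p f G (Ideal.span ({c₁, c₂} : Set R)) := by
  set N := Ideal.span ({c₁, c₂} : Set R) with hN
  have hNm : N ≤ maximalIdeal R := span_pair_le_maximalIdeal_of_span_triple h
  rcases hcurve with hall | ⟨c', hc'm, hc'2⟩
  · -- `ν = 0`: no `v − c^p` lies in `𝔪`
    refine cleanPermissibleAt_of_unit_rep f hR hdim h cc hcc hv hd hrep (Or.inl fun c hc => ?_)
    exact hall (Ideal.Quotient.mk N c) ((sub_pow_mem_iff_mk N (maximalIdeal R) p hNm v c).mp hc)
  · -- `ν = 1`: lift `c̄`; `v − c^p ∈ 𝔪 ∖ (N + 𝔪²)`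
    obtain ⟨c, rfl⟩ := Ideal.Quotient.mk_surjective c'
    refine cleanPermissibleAt_of_unit_rep f hR hdim h cc hcc hv hd hrep (Or.inr (Or.inl ⟨c, ?_, ?_⟩))
    · exact (sub_pow_mem_iff_mk N (maximalIdeal R) p hNm v c).mpr hc'm
    · exact fun hc => hc'2 ((sub_pow_mem_sup_pow_iff_mk N (maximalIdeal R) p 2 v c).mp hc)

include hR hdim h hcc hv hd hrep in
/-- **Contrapositive: an obstruction point with a unit representative has birth order `≥ 2` on the curve** — every `v̄ − c̄^p` that vanishes at the point
vanishes to second order on `R/N` (and some does vanish): these are exactly the points counted by ✓ `card_mul_le_of_add_pow_mem_sq` once `R/N` is read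
in the coordinate ring of the line. [cite: CossartPiltant2008, Prop. 4.4 (proof, p. 11)] -/
theorem two_le_birthOrder_of_not_cleanPermissibleAt (hnot : ¬ CleanPermissibleAt p f G (Ideal.span ({c₁, c₂} : Set R))) :
    (∃ c' : R ⧸ Ideal.span ({c₁, c₂} : Set R),
        Ideal.Quotient.mk _ v - c' ^ p ∈ (maximalIdeal R).map (Ideal.Quotient.mk (Ideal.span ({c₁, c₂} : Set R)))) ∧
      ∀ c' : R ⧸ Ideal.span ({c₁, c₂} : Set R),
        Ideal.Quotient.mk _ v - c' ^ p ∈ (maximalIdeal R).map (Ideal.Quotient.mk (Ideal.span ({c₁, c₂} : Set R))) →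
        Ideal.Quotient.mk _ v - c' ^ p ∈ (maximalIdeal R).map (Ideal.Quotient.mk (Ideal.span ({c₁, c₂} : Set R))) ^ 2 := by
  by_contra hcon
  apply hnot
  refine cleanPermissibleAt_of_unit_rep_of_quotient f hR hdim h cc hcc hv hd hrep ?_
  by_cases hex : ∃ c' : R ⧸ Ideal.span ({c₁, c₂} : Set R),
      Ideal.Quotient.mk _ v - c' ^ p ∈ (maximalIdeal R).map (Ideal.Quotient.mk (Ideal.span ({c₁, c₂} : Set R)))
  · right
    by_contra hno
    apply hcon
    refine ⟨hex, fun c' hc' => ?_⟩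
    by_contra h2
    exact hno ⟨c', hc', h2⟩
  · left
    exact fun c' hc' => hex ⟨c', hc'⟩

end Curve

end Summit.ResolutionOfSingularities.ResolutionOfSingularities.Theorems.RadicialJung.CleanModels

end
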